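import Summits.NavierStokesRegularity.NavierStokesRegularity.Theorems.ScenarioCensusRowF1ax
import Summits.NavierStokesRegularity.NavierStokesRegularity.Theorems.ScenarioCensusRowA7h
import Summits.NavierStokesRegularity.NavierStokesRegularity.Theorems.DssFarFieldSlavingBlowupTypeIDssProfileSimilarityEnstrophyBeltramiLiouville
import Summits.NavierStokesRegularity.NavierStokesRegularity.Theorems.SqueezeCycleSingularZoomWindow
import Summits.NavierStokesRegularity.NavierStokesRegularity.Theorems.ClockStretchingLawClockCeilingZoomDerivLimit
import Summits.NavierStokesRegularity.NavierStokesRegularity.Theorems.PoloidalWindowDoorPoloidalWindowRigidityVorticityTranslate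
import Literature.Analysis.FluidPDE.HarmonicLiouvilleLp
import Literature.Analysis.FluidPDE.BoundedAnnihilator
import HarnessLib

/-!
# Census row F1, family «SECOND-ORDER TOP» (F1vfq ⊇ F1afq, F1vgq; o-forms F1vf / F1vg / F1af) — LINE «inviscid-top» port, part 1/5: levels, the
# dimensionless Type-I constant, the three second-order defects and their read-outs (§1); second-order calculus of zooms and the `C²_loc` convergence tool (§2)

Re-homed for the scenario census (typer seat ns-census-typer-1 g8; the cells F1vfq ⊇ F1afq, F1vgq and the o-forms F1vf / F1vg / F1af are MEMBERS OF RECORD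
«DECIDED IN KERNEL IN FILES» of row F1 since census v1.71 (critic idea-crit-3 PASS 21:40:30Z; ref ns-census-ref g8 PRE-CHECK ✓ §13.14 item 17; lead-presearch
label); this port makes them TREE-decided): VERBATIM PORT of ns-idea-3 LINE 18 «inviscid-top», `pub/ideators/ns-idea-3/lines/inviscid-top/line-inviscid-top.lean`
sha16 75cdf592fc13b830 (1259 l., lean check rc 0, 0 sorry), split for the 400-line rule into `ScenarioCensusRowF1Inviscid` (§1–§2) → `…InviscidZoom` (§3) →
`…InviscidLiouville` (§4) → `…InviscidTransfer` (§5) → `…InviscidTop` (§6 + census KEYS).  Lean text VERBATIM in namespace `…Theorems.ScenarioCensus.InviscidTop`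
(the line's `…Cruxes.ScenarioCensusRowF1.InviscidTopLine` re-homed); port edits: `@[conjecture]` on the residual `LaplacianDefectSlack` (≡ `ScenarioCensus.Row_F1`,
OPEN), fifteen one-line docstrings added (gate lint).

No census VALUE is moved here (row F1 stays OPEN-WITH-LINE; the members become TREE-decided by name); NS regularity is NOT proved; `Row_F1` is
untouched (zero movement, `laplacianDefectSlack_iff_rowF1`); no summit statement is proved by this file. Lemmas that restate already-landed tree declarations are taken BY NAME (gate lint `dedup.landed`): `tendsto_physicalTime` = `ColumnarTop.tendsto_physicalTime`, `eventually_fast` = `ColumnarTop.eventually_fast`, `sqrt_timeLag` = `StretchedTop.sqrt_timeLag`, `forall_of_forall_ne_zero` = `StretchedTop.forall_of_forall_ne_zero`.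
-/

-- the summit and its single problem share the name `NavierStokesRegularity` (D-0017 nested layout)
set_option linter.dupNamespace false

noncomputable section

open MeasureTheory Set Function Filter TopologicalSpace Metric
open scoped Topology NNReal ENNReal InnerProductSpace RealInnerProductSpace Laplacian

namespace Summit.NavierStokesRegularity.NavierStokesRegularity.Theorems.ScenarioCensus.InviscidTop

open Literature.Analysis Literature.Analysis.FluidPDE
open Summit.NavierStokesRegularity.NavierStokesRegularity.Theorems

/-- `ℝ³`. -/
abbrev E3 := EuclideanSpace ℝ (Fin 3)

/-- The space of Hessians `D²v(x) : ℝ³ →L (ℝ³ →L ℝ³)`. -/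
abbrev Hess := E3 →L[ℝ] E3 →L[ℝ] E3

/-! ## §1 Levels, the dimensionless Type-I constant, the three second-order defects, rows, floor, residual -/

/-- **Subcritical (moving) speed level**: `Λ(t) √(T − t) → 0` as `t ↑ T`. -/
def IsSubcriticalLevel (T : ℝ) (Λ : ℝ → ℝ) : Prop :=
  Tendsto (fun t => Λ t * Real.sqrt (T - t)) (𝓝[<] T) (𝓝 0)

/-- **Type-I blow-up with dimensionless constant `M`**: eventually `√(T − t) ‖u(t, x)‖ ≤ M √ν`. -/
def IsTypeIBlowupWith (M ν : ℝ) (u : ℝ → E3 → E3) (T : ℝ) : Prop :=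
  ∀ᶠ t in 𝓝[<] T, ∀ x : E3, Real.sqrt (T - t) * ‖u t x‖ ≤ M * Real.sqrt ν

/-- The dimensionless second-order clock weight `√ν (T − t)^{3/2}`. -/
def clock₂ (ν T t : ℝ) : ℝ := Real.sqrt ν * ((T - t) * Real.sqrt (T - t))

/-- **ε-INVISCID TOP** (viscous-force defect): eventually, at every `Λ t`-fast point,
`√ν (T − t)^{3/2} ‖Δu(t, x)‖ ≤ ε` — i.e. the viscous force `ν Δu` felt by the fast fluid is at most
`ε √ν (T − t)^{-3/2}`, an `ε`-fraction of the Type-I inertial scale `U/τ = M √ν (T − t)^{-3/2}`. -/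
def HasLaplacianDefectAt (T : ℝ) (Λ : ℝ → ℝ) (ν ε : ℝ) (u : ℝ → E3 → E3) : Prop :=
  ∀ᶠ t in 𝓝[<] T, ∀ x : E3, Λ t < ‖u t x‖ → clock₂ ν T t * ‖(Δ (u t)) x‖ ≤ ε

/-- **ε-UNIFORM-VORTICITY TOP** (vorticity-gradient defect): eventually, at every fast point,
`√ν (T − t)^{3/2} ‖∇ω(t, x)‖ ≤ ε`. -/
def HasVorticityGradientDefectAt (T : ℝ) (Λ : ℝ → ℝ) (ν ε : ℝ) (u : ℝ → E3 → E3) : Prop :=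
  ∀ᶠ t in 𝓝[<] T, ∀ x : E3, Λ t < ‖u t x‖ → clock₂ ν T t * ‖fderiv ℝ (curl (u t)) x‖ ≤ ε

/-- **ε-AFFINE TOP** (Hessian defect): eventually, at every fast point, `√ν (T − t)^{3/2} ‖∇²u(t, x)‖ ≤ ε`. -/
def HasHessianDefectAt (T : ℝ) (Λ : ℝ → ℝ) (ν ε : ℝ) (u : ℝ → E3 → E3) : Prop :=
  ∀ᶠ t in 𝓝[<] T, ∀ x : E3, Λ t < ‖u t x‖ → clock₂ ν T t * ‖fderiv ℝ (fderiv ℝ (u t)) x‖ ≤ ε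

/-- Constant levels are subcritical. -/
theorem isSubcriticalLevel_const (T Λ : ℝ) : IsSubcriticalLevel T (fun _ => Λ) := by
  have h : Tendsto (fun t : ℝ => Λ * Real.sqrt (T - t)) (𝓝 T) (𝓝 (Λ * Real.sqrt (T - T))) :=
    ((continuous_const.sub continuous_id).sqrt.tendsto T).const_mul Λ
  rw [sub_self, Real.sqrt_zero, mul_zero] at h
  exact h.mono_left nhdsWithin_le_nhds

/-- The second-order clock is non-negative. -/
theorem clock₂_nonneg (ν T t : ℝ) : 0 ≤ clock₂ ν T t := by
  unfold clock₂
  by_cases h : 0 ≤ T - t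
  · positivity
  · push Not at h
    rw [Real.sqrt_eq_zero'.2 h.le, mul_zero, mul_zero]

/-- Monotonicity of the defects in `ε`. -/
theorem HasLaplacianDefectAt.mono {T ν : ℝ} {Λ : ℝ → ℝ} {ε ε' : ℝ} {u : ℝ → E3 → E3}
    (h : HasLaplacianDefectAt T Λ ν ε u) (hε : ε ≤ ε') : HasLaplacianDefectAt T Λ ν ε' u :=
  Filter.Eventually.mono h fun _ ht x hx => (ht x hx).trans hε

/-- Monotonicity of the vorticity-gradient defect in `ε`. -/
theorem HasVorticityGradientDefectAt.mono {T ν : ℝ} {Λ : ℝ → ℝ} {ε ε' : ℝ} {u : ℝ → E3 → E3}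
    (h : HasVorticityGradientDefectAt T Λ ν ε u) (hε : ε ≤ ε') : HasVorticityGradientDefectAt T Λ ν ε' u :=
  Filter.Eventually.mono h fun _ ht x hx => (ht x hx).trans hε

/-- Monotonicity of the Hessian defect in `ε`. -/
theorem HasHessianDefectAt.mono {T ν : ℝ} {Λ : ℝ → ℝ} {ε ε' : ℝ} {u : ℝ → E3 → E3}
    (h : HasHessianDefectAt T Λ ν ε u) (hε : ε ≤ ε') : HasHessianDefectAt T Λ ν ε' u :=
  Filter.Eventually.mono h fun _ ht x hx => (ht x hx).trans hε

/-- A dimensionless Type-I bound is a Type-I bound. -/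
theorem IsTypeIBlowupWith.isTypeIBlowup {M ν T : ℝ} {u : ℝ → E3 → E3} (h : IsTypeIBlowupWith M ν u T) :
    IsTypeIBlowup u T := by
  refine ⟨M * Real.sqrt ν, ?_⟩
  filter_upwards [h, self_mem_nhdsWithin] with t ht htT x
  have htT' : t < T := htT
  have hs : 0 < Real.sqrt (T - t) := Real.sqrt_pos.2 (sub_pos.2 htT')
  rw [le_div_iff₀ hs, mul_comm]
  exact ht x

/-- Every Type-I blow-up has a dimensionless constant (`M = C/√ν`). -/
theorem exists_isTypeIBlowupWith {ν T : ℝ} (hν : 0 < ν) {u : ℝ → E3 → E3} (h : IsTypeIBlowup u T) :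
    ∃ M : ℝ, IsTypeIBlowupWith M ν u T := by
  obtain ⟨C, hC⟩ := h
  refine ⟨C / Real.sqrt ν, ?_⟩
  have hsν : 0 < Real.sqrt ν := Real.sqrt_pos.2 hν
  filter_upwards [hC, self_mem_nhdsWithin] with t ht htT x
  have htT' : t < T := htT
  have hs : 0 < Real.sqrt (T - t) := Real.sqrt_pos.2 (sub_pos.2 htT')
  rw [div_mul_cancel₀ C hsν.ne']
  have h1 := ht x
  rw [le_div_iff₀ hs] at h1
  rw [mul_comm]
  exact h1

/-! ### The three read-outs of a Hessian -/

/-- The coordinate unit vectors. -/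
abbrev eI (i : Fin 3) : E3 := EuclideanSpace.single i (1 : ℝ)

/-- Trace read-out: `Σᵢ H eᵢ eᵢ` (the Laplacian, when `H = D²v(x)`). -/
def lapOf (H : Hess) : E3 := ∑ i, H (eI i) (eI i)

/-- Vorticity-gradient read-out: `curlCLM ∘ H` (`= ∇(curl v)(x)` when `H = D²v(x)`, `v ∈ C²`). -/
def vortGradOf (H : Hess) : E3 →L[ℝ] E3 := (curlCLM : (E3 →L[ℝ] E3) →L[ℝ] E3).comp H

/-- `lapOf` is homogeneous. -/
theorem lapOf_smul (a : ℝ) (H : Hess) : lapOf (a • H) = a • lapOf H := by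
  simp only [lapOf, _root_.smul_apply, Finset.smul_sum]

/-- `vortGradOf` is homogeneous. -/
theorem vortGradOf_smul (a : ℝ) (H : Hess) : vortGradOf (a • H) = a • vortGradOf H := by
  simp only [vortGradOf, ContinuousLinearMap.comp_smul]

/-- `lapOf` is continuous. -/
theorem continuous_lapOf : Continuous lapOf := by
  unfold lapOf
  refine continuous_finsetSum _ fun i _ => ?_
  exact ((ContinuousLinearMap.apply ℝ E3 (eI i)).continuous).comp
    ((ContinuousLinearMap.apply ℝ (E3 →L[ℝ] E3) (eI i)).continuous)

/-- `vortGradOf` is continuous. -/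
theorem continuous_vortGradOf : Continuous vortGradOf :=
  ((ContinuousLinearMap.compL ℝ E3 (E3 →L[ℝ] E3) E3) curlCLM).continuous

/-- `Δ v (x) = Σᵢ D²v(x) eᵢ eᵢ` (Mathlib's Laplacian on the standard orthonormal basis of `ℝ³`). -/
theorem laplacian_eq_lapOf (v : E3 → E3) (x : E3) : (Δ v) x = lapOf (fderiv ℝ (fderiv ℝ v) x) := by
  rw [InnerProductSpace.laplacian_eq_iteratedFDeriv_orthonormalBasis v (EuclideanSpace.basisFun (Fin 3) ℝ)]
  simp only [lapOf]
  refine Finset.sum_congr rfl fun i _ => ?_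
  rw [iteratedFDeriv_two_apply, EuclideanSpace.basisFun_apply]
  rfl

/-- `∇(curl v)(x) = curlCLM ∘ D²v(x)` for `v ∈ C²`. -/
theorem fderiv_curl_eq_vortGradOf {v : E3 → E3} {n : WithTop ℕ∞} (hv : ContDiff ℝ n v) (hn : 2 ≤ n)
    (x : E3) : fderiv ℝ (curl v) x = vortGradOf (fderiv ℝ (fderiv ℝ v) x) := by
  have hd : DifferentiableAt ℝ (fderiv ℝ v) x :=
    ((hv.of_le hn).fderiv_right (m := 1) (by norm_num)).differentiable (by norm_num) x
  rw [curl_eq_curlCLM_comp]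
  exact ((curlCLM : (E3 →L[ℝ] E3) →L[ℝ] E3).hasFDerivAt.comp x hd.hasFDerivAt).fderiv

/-- `‖Σᵢ H eᵢ eᵢ‖ ≤ 3 ‖H‖`. -/
theorem norm_lapOf_le (H : Hess) : ‖lapOf H‖ ≤ 3 * ‖H‖ := by
  unfold lapOf
  have h1 : ∀ i, ‖H (eI i) (eI i)‖ ≤ ‖H‖ := fun i => by
    have hn : ‖eI i‖ = 1 := by simp [eI]
    calc ‖H (eI i) (eI i)‖ ≤ ‖H (eI i)‖ * ‖eI i‖ := ContinuousLinearMap.le_opNorm _ _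
      _ ≤ ‖H‖ * ‖eI i‖ * ‖eI i‖ := mul_le_mul_of_nonneg_right (ContinuousLinearMap.le_opNorm _ _) (norm_nonneg _)
      _ = ‖H‖ := by rw [hn, mul_one, mul_one]
  calc ‖∑ i, H (eI i) (eI i)‖ ≤ ∑ i, ‖H (eI i) (eI i)‖ := norm_sum_le _ _
    _ ≤ ∑ _i : Fin 3, ‖H‖ := Finset.sum_le_sum fun i _ => h1 i
    _ = 3 * ‖H‖ := by simp

/-! ## §2 Second-order calculus of zooms and the `C²_loc` convergence tool -/

/-- Gradient of a rescaled field (pointwise; no differentiability needed). -/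
theorem fderiv_smul_stPull_apply {F : Type*} [NormedAddCommGroup F] [NormedSpace ℝ F]
    (a β γ t₀ : ℝ) (x₀ : E3) (ψ : ℝ → E3 → F) (s : ℝ) (y : E3) :
    fderiv ℝ ((a • stPull β γ t₀ x₀ ψ) s) y = (a * γ) • fderiv ℝ (ψ (t₀ + β * s)) (x₀ + γ • y) := by
  rw [show (a • stPull β γ t₀ x₀ ψ) s = a • stPull β γ t₀ x₀ ψ s from rfl, fderiv_const_smul_field,
    Pi.smul_apply, fderiv_stPull, smul_smul]

/-- Gradient of a rescaled field as a rescaled field of gradients. -/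
theorem fderiv_smul_stPull {F : Type*} [NormedAddCommGroup F] [NormedSpace ℝ F]
    (a β γ t₀ : ℝ) (x₀ : E3) (ψ : ℝ → E3 → F) (s : ℝ) :
    fderiv ℝ ((a • stPull β γ t₀ x₀ ψ) s) =
      ((a * γ) • stPull β γ t₀ x₀ (fun t x => fderiv ℝ (ψ t) x)) s := by
  funext y
  rw [fderiv_smul_stPull_apply]
  rfl

/-- **Hessian of a rescaled field**: `D²[(a ψ(t₀ + β·, x₀ + γ·)) s](y) = (a γ²) D²ψ(t₀ + β s)(x₀ + γ y)`
(no differentiability hypotheses: both sides are junk together). -/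
theorem fderiv_fderiv_smul_stPull {F : Type*} [NormedAddCommGroup F] [NormedSpace ℝ F]
    (a β γ t₀ : ℝ) (x₀ : E3) (ψ : ℝ → E3 → F) (s : ℝ) (y : E3) :
    fderiv ℝ (fderiv ℝ ((a • stPull β γ t₀ x₀ ψ) s)) y =
      (a * γ * γ) • fderiv ℝ (fderiv ℝ (ψ (t₀ + β * s))) (x₀ + γ • y) := by
  rw [fderiv_smul_stPull]
  exact fderiv_smul_stPull_apply (a * γ) β γ t₀ x₀ (fun t x => fderiv ℝ (ψ t) x) s y

/-- Hessian of the `𝒦`-zoom `c • W(c² s, x₀ + c y)`. -/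
theorem fderiv_fderiv_zoom (c : ℝ) (x₀ : E3) (W : ℝ → E3 → E3) (s : ℝ) (y : E3) :
    fderiv ℝ (fderiv ℝ ((c • stPull (c ^ 2) c 0 x₀ W) s)) y =
      (c ^ 3) • fderiv ℝ (fderiv ℝ (W (c ^ 2 * s))) (x₀ + c • y) := by
  rw [fderiv_fderiv_smul_stPull, zero_add, show c * c * c = c ^ 3 by ring]

/-- **Operator convergence from convergence on the coordinate vectors** (finite-dimensional source). -/
theorem tendsto_clm_of_tendsto_apply {G : Type*} [NormedAddCommGroup G] [NormedSpace ℝ G]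
    {A : ℕ → E3 →L[ℝ] G} {B : E3 →L[ℝ] G}
    (h : ∀ i : Fin 3, Tendsto (fun n => A n (eI i)) atTop (𝓝 (B (eI i)))) : Tendsto A atTop (𝓝 B) := by
  have key : ∀ L : E3 →L[ℝ] G,
      L = ∑ i, (EuclideanSpace.proj i : E3 →L[ℝ] ℝ).smulRight (L (eI i)) := by
    intro L
    ext v
    rw [_root_.sum_apply]
    simp only [ContinuousLinearMap.smulRight_apply]
    conv_lhs => rw [← (EuclideanSpace.basisFun (Fin 3) ℝ).sum_repr v]
    rw [map_sum]
    refine Finset.sum_congr rfl fun i _ => ?_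
    rw [map_smul, EuclideanSpace.basisFun_apply, EuclideanSpace.basisFun_repr]
    rfl
  rw [key B, show A = fun n => ∑ i, (EuclideanSpace.proj i : E3 →L[ℝ] ℝ).smulRight (A n (eI i)) from
    funext fun n => key (A n)]
  refine tendsto_finsetSum _ fun i _ => ?_
  have hc : Continuous fun f : G => (EuclideanSpace.proj i : E3 →L[ℝ] ℝ).smulRight f :=
    (ContinuousLinearMap.smulRightL ℝ E3 G (EuclideanSpace.proj i)).continuous
  exact (hc.tendsto _).comp (h i)

/-- **Second derivatives of pointwise-`C¹`-convergent sequences under a uniform `C³` bound** (the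
elementary lemma `tendsto_deriv_of_forall_lipschitz` of the tree applied along lines to `y ↦ D Fₙ(y)`):
`D Fₙ → D F₀` pointwise and `‖D³Fₙ‖ ≤ K` ⇒ `D²Fₙ(x) e → D²F₀(x) e` for every `x, e`. -/
theorem tendsto_fderiv_fderiv_apply_of_bound {G : Type*} [NormedAddCommGroup G] [NormedSpace ℝ G]
    {F : ℕ → E3 → G} {F₀ : E3 → G} {K : ℝ}
    (hF : ∀ n, ContDiff ℝ 3 (F n)) (hF₀ : ContDiff ℝ 2 F₀)
    (h3 : ∀ n y, ‖iteratedFDeriv ℝ 3 (F n) y‖ ≤ K)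
    (hgrad : ∀ y, Tendsto (fun n => fderiv ℝ (F n) y) atTop (𝓝 (fderiv ℝ F₀ y))) (x e : E3) :
    Tendsto (fun n => fderiv ℝ (fderiv ℝ (F n)) x e) atTop (𝓝 (fderiv ℝ (fderiv ℝ F₀) x e)) := by
  have h2 : ∀ n, ContDiff ℝ 2 (fderiv ℝ (F n)) := fun n => (hF n).fderiv_right (by norm_cast)
  have hd1 : ∀ n, Differentiable ℝ (fderiv ℝ (F n)) := fun n => (h2 n).differentiable (by norm_num)
  have hd2 : ∀ n, Differentiable ℝ (fderiv ℝ (fderiv ℝ (F n))) := fun n =>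
    ((h2 n).fderiv_right (m := 1) (by norm_cast)).differentiable (by norm_num)
  have hline : ∀ ρ : ℝ, HasDerivAt (fun σ : ℝ => x + σ • e) e ρ := fun ρ => by
    simpa using ((hasDerivAt_id ρ).smul_const e).const_add x
  have hder : ∀ n (ρ : ℝ), HasDerivAt (fun σ : ℝ => fderiv ℝ (F n) (x + σ • e))
      (fderiv ℝ (fderiv ℝ (F n)) (x + ρ • e) e) ρ := fun n ρ =>
    ((hd1 n) (x + ρ • e)).hasFDerivAt.comp_hasDerivAt ρ (hline ρ)
  have hlipF : ∀ n (ρ : ℝ), 0 ≤ ρ →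
      ‖fderiv ℝ (fderiv ℝ (F n)) (x + ρ • e) e - fderiv ℝ (fderiv ℝ (F n)) x e‖ ≤
        K * ‖e‖ ^ 2 * (ρ - 0) := by
    intro n ρ hρ
    have hmv := Convex.norm_image_sub_le_of_norm_fderiv_le (𝕜 := ℝ) (f := fderiv ℝ (fderiv ℝ (F n)))
      (fun y _ => hd2 n y) (fun y _ => by
        rw [Theorems.norm_fderiv_fderiv_eq_norm_iteratedFDeriv_two, norm_iteratedFDeriv_fderiv]
        exact h3 n y) convex_univ (mem_univ x) (mem_univ (x + ρ • e))
    rw [add_sub_cancel_left, norm_smul, Real.norm_of_nonneg hρ] at hmv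
    have e1 : fderiv ℝ (fderiv ℝ (F n)) (x + ρ • e) e - fderiv ℝ (fderiv ℝ (F n)) x e =
        (fderiv ℝ (fderiv ℝ (F n)) (x + ρ • e) - fderiv ℝ (fderiv ℝ (F n)) x) e := rfl
    rw [e1]
    calc ‖(fderiv ℝ (fderiv ℝ (F n)) (x + ρ • e) - fderiv ℝ (fderiv ℝ (F n)) x) e‖
        ≤ ‖fderiv ℝ (fderiv ℝ (F n)) (x + ρ • e) - fderiv ℝ (fderiv ℝ (F n)) x‖ * ‖e‖ :=
          ContinuousLinearMap.le_opNorm _ _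
      _ ≤ K * (ρ * ‖e‖) * ‖e‖ := mul_le_mul_of_nonneg_right hmv (norm_nonneg _)
      _ = K * ‖e‖ ^ 2 * (ρ - 0) := by ring
  have hlim := tendsto_deriv_of_forall_lipschitz (f := fun n (σ : ℝ) => fderiv ℝ (F n) (x + σ • e))
    (f' := fun n (ρ : ℝ) => fderiv ℝ (fderiv ℝ (F n)) (x + ρ • e) e)
    (g := fun σ : ℝ => fderiv ℝ F₀ (x + σ • e))
    (t := 0) (r := 1) one_pos (fun n ρ _ => hder n ρ)
    (fun n ρ hρ => by simpa only [zero_add, zero_smul, add_zero] using hlipF n ρ hρ.1)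
    (fun σ _ => hgrad (x + σ • e)) (d := fderiv ℝ (fderiv ℝ F₀) x e) (by
      have hd0 : Differentiable ℝ (fderiv ℝ F₀) :=
        (hF₀.fderiv_right (m := 1) (by norm_cast)).differentiable (by norm_num)
      have h : HasDerivAt (fun σ : ℝ => fderiv ℝ F₀ (x + σ • e))
          (fderiv ℝ (fderiv ℝ F₀) (x + (0 : ℝ) • e) e) 0 :=
        (hd0 (x + (0 : ℝ) • e)).hasFDerivAt.comp_hasDerivAt (0 : ℝ) (hline 0)
      simpa only [zero_smul, add_zero] using h)
  simpa only [zero_smul, add_zero] using hlim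

/-- The same with full operator convergence of the Hessians. -/
theorem tendsto_fderiv_fderiv_of_bound {G : Type*} [NormedAddCommGroup G] [NormedSpace ℝ G]
    {F : ℕ → E3 → G} {F₀ : E3 → G} {K : ℝ}
    (hF : ∀ n, ContDiff ℝ 3 (F n)) (hF₀ : ContDiff ℝ 2 F₀)
    (h3 : ∀ n y, ‖iteratedFDeriv ℝ 3 (F n) y‖ ≤ K)
    (hgrad : ∀ y, Tendsto (fun n => fderiv ℝ (F n) y) atTop (𝓝 (fderiv ℝ F₀ y))) (x : E3) :
    Tendsto (fun n => fderiv ℝ (fderiv ℝ (F n)) x) atTop (𝓝 (fderiv ℝ (fderiv ℝ F₀) x)) :=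
  tendsto_clm_of_tendsto_apply fun i => tendsto_fderiv_fderiv_apply_of_bound hF hF₀ h3 hgrad x (eI i)

/-! ### Hessian (`C²_loc`) convergence of Type-I mild sequences — the line's new extraction tool -/

/-- **`C²_loc` convergence along a `C¹_loc`-convergent sequence of Type-I Oseen-mild window fields**
(windows `(A k, 0) × ℝ³` with `A k → −∞`): the uniform `D³` bound (KNSS 2009 (4.10)) one order above the
tree's gradient tool upgrades pointwise gradient convergence to pointwise HESSIAN convergence. -/
theorem tendsto_fderiv_fderiv_of_typeI_seq_Ioo {C C' : ℝ} {A : ℕ → ℝ} (hA : Tendsto A atTop atBot)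
    {w : ℕ → ℝ → E3 → E3}
    (hc : ∀ k, ContinuousOn (uncurry (w k)) (Ioo (A k) 0 ×ˢ univ))
    (hdivw : ∀ k, ∀ t ∈ Ioo (A k) 0, IsWeaklyDivFree (w k t))
    (hmild : ∀ k, ∀ s t : ℝ, A k < s → s < t → t < 0 → ∀ x,
      w k t x = UnboundedOperators.heatExtension (w k s) (t - s) x - oseenDuhamel 1 s (w k) (w k) t x)
    (hI : ∀ k, ∀ t ∈ Ioo (A k) 0, ∀ x, ‖w k t x‖ ≤ C / Real.sqrt (-t))
    {W : ℝ → E3 → E3} (hW : IsTypeIAncientMild C' W)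
    (hgrad : ∀ t < 0, ∀ x, Tendsto (fun k => fderiv ℝ (w k t) x) atTop (𝓝 (fderiv ℝ (W t) x))) :
    ∀ t < 0, ∀ x, Tendsto (fun k => fderiv ℝ (fderiv ℝ (w k t)) x) atTop
      (𝓝 (fderiv ℝ (fderiv ℝ (W t)) x)) := by
  intro t ht x
  have hab : t - 1 < t / 2 := by linarith
  have hb : t / 2 < 0 := by linarith
  obtain ⟨K, hK⟩ := exists_norm_iteratedFDeriv_le_of_typeI_Ioo C 3 hab hb one_pos
  obtain ⟨N, hN⟩ := eventually_atTop.1 (hA.eventually (eventually_lt_atBot (t - 1)))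
  have hsm : ∀ k, ContDiffOn ℝ (⊤ : ℕ∞) (uncurry (w k)) (Ioo (A k) 0 ×ˢ univ) := fun k =>
    contDiffOn_of_Ioo (hc k) (hdivw k) (hmild k) (hI k)
  have htA : ∀ n, t ∈ Ioo (A (n + N)) 0 := fun n =>
    ⟨by linarith [hN (n + N) (Nat.le_add_left N n)], ht⟩
  have hF : ∀ n, ContDiff ℝ 3 (w (n + N) t) := fun n =>
    ((hsm (n + N)).comp_contDiff (contDiff_prodMk_right t) fun y => ⟨htA n, mem_univ y⟩).of_le
      (by norm_cast)
  have hF₀ : ContDiff ℝ 2 (W t) := (hW.contDiff_slice ht).of_le (by norm_cast)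
  have h3 : ∀ n y, ‖iteratedFDeriv ℝ 3 (w (n + N) t) y‖ ≤ K := fun n y =>
    hK (hN (n + N) (Nat.le_add_left N n)) (hc _) (hdivw _) (hmild _) (hI _) t
      ⟨by linarith, by linarith⟩ y
  have hg : ∀ y, Tendsto (fun n => fderiv ℝ (w (n + N) t) y) atTop (𝓝 (fderiv ℝ (W t) y)) :=
    fun y => (hgrad t ht y).comp (tendsto_add_atTop_nat N)
  exact (tendsto_add_atTop_iff_nat N).1 (tendsto_fderiv_fderiv_of_bound hF hF₀ h3 hg x)

/-- **`C²_loc` convergence in the Type-I ancient mild class `𝒦_C`.** -/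
theorem tendsto_fderiv_fderiv_of_isTypeIAncientMild_seq {C : ℝ} {v : ℕ → ℝ → E3 → E3}
    (hv : ∀ n, IsTypeIAncientMild C (v n)) {U : ℝ → E3 → E3} (hU : IsTypeIAncientMild C U)
    (hgrad : ∀ s < 0, ∀ y, Tendsto (fun n => fderiv ℝ (v n s) y) atTop (𝓝 (fderiv ℝ (U s) y))) :
    ∀ s < 0, ∀ y, Tendsto (fun n => fderiv ℝ (fderiv ℝ (v n s)) y) atTop
      (𝓝 (fderiv ℝ (fderiv ℝ (U s)) y)) := by
  have hA : Tendsto (fun n : ℕ => -((n : ℝ) + 1)) atTop atBot :=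
    tendsto_neg_atTop_atBot.comp (tendsto_atTop_add_const_right _ _ tendsto_natCast_atTop_atTop)
  exact tendsto_fderiv_fderiv_of_typeI_seq_Ioo (C := C) hA
    (fun n => (hv n).continuousOn_uncurry.mono (prod_mono Ioo_subset_Iio_self Subset.rfl))
    (fun n t ht => (hv n).isWeaklyDivFree ht.2)
    (fun n s t _ hst ht x => (hv n).mild_eq_heatExtension hst ht x)
    (fun n t ht x => (hv n).norm_le ht.2 x) hU hgrad

end Summit.NavierStokesRegularity.NavierStokesRegularity.Theorems.ScenarioCensus.InviscidTop

end
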